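import Summits.CriticalPhenomena.PercolationContinuityZ3.Theorems.SahiAEBand
import Summits.CriticalPhenomena.PercolationContinuityZ3.Theorems.SahiAEBandSupport
import Summits.CriticalPhenomena.PercolationContinuityZ3.Theorems.SahiAEPlaneZerosPrelim
import Summits.CriticalPhenomena.PercolationContinuityZ3.Theorems.SahiAESublatticeVersion

/-!
# The planar structure theorem for densities WITH ZEROS: every a.e.-TP₂ density on `ℝ²` has a Borel version TP₂ at every pair

Support file of the Sahi cell (`prim-sahi`, typer seat, generation 24; `--supports stmt-CriticalPhenomena-4575`).
Theorems only (no definitions, no named facts, no sorries).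

**Theorem** (`Plane.exists_measurable_tp2_version_of_ae_zeros`).  Let `f : ℝ² → [0, ∞]` be measurable, almost
everywhere finite, and TP₂ on Lebesgue-almost every pair: `f(x) f(y) ≤ f(x ∧ y) f(x ∨ y)` for `λ² ⊗ λ²`-a.e. `(x, y)`.
Then there is a Borel `F : ℝ² → [0, ∞)`, `F = f` almost everywhere, with `F(x) F(y) ≤ F(x ∧ y) F(x ∨ y)` for ALL
`x, y ∈ ℝ²`.  No positivity, no bounds, no hypothesis on the support.  This settles, in the plane, the question left
open in `SahiAEVersion.lean` (`exists_mtp2_version_of_ae`: a non-measurable version by an ultrafilter limit) and in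
the cell's paper: positive densities were done in every dimension (`SahiAEOrthantGluing.lean`), `{0,1}`-valued ones in
`SahiAESublatticeVersion.lean`; here the zero set is arbitrary.

**Proof.**  Let `S = {f ≠ 0}` and `X₀`, `X₁ ⊆ ℝ` the abscissae / ordinates of its non-null vertical / horizontal
sections; `S ⊆ X₀ × X₁` a.e. (Fubini).  Transport `λ|_{X₀} ⊗ λ|_{X₁}` (equivalently the product of the atomless
probability measures `(λ|_{Xᵢ}).toFinite`) to Lebesgue measure on the open unit square along the coordinatewise
quantile maps (`SahiAEVersionTransport(Prelim).lean`): the transported density `g = f ∘ T` is a.e.-TP₂ on the square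
and — this is the point of the transport — its support has NO NULL ROWS OR COLUMNS.  Its support is an almost
sublattice, a.e. equal to an honest measurable sublattice `L` of the square (`SahiAESublatticeVersion.lean`), every
a.e. line of the square meets `L`, so `L` is a.e. an OPEN BAND `B` (`SahiAEBandSupport.lean`, the measurable
double-echelon theorem).  The band theorem (`SahiAEBand.lean`) gives a Borel version `G` of `𝟙_B g`, TP₂ at every
pair of `ℝ²`; finally `F = 𝟙_{X₀ × X₁} · (G ∘ cdf × cdf)` (the distribution functions are monotone everywhere, so
this is TP₂ at every pair, and `cdf ∘ quantile = id` a.e.).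

No sorries, no new axioms.
-/

noncomputable section

namespace Summit.CriticalPhenomena.PercolationContinuityZ3.Theorems.SahiAEFourFunctions

namespace Plane

open MeasureTheory Set Filter Topology Function ProbabilityTheory
open Summit.CriticalPhenomena.PercolationContinuityZ3.Theorems.SahiBoxTP2 (IsBoxTP2)
open scoped ENNReal NNReal

/-! ### The theorem -/

/-- **The planar structure theorem for densities with zeros.**  Every measurable, almost everywhere finite
`f : ℝ² → [0, ∞]` which is TP₂ on Lebesgue-almost every pair has a Borel, everywhere finite version which is TP₂ at
EVERY pair of `ℝ²`. [this work] -/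
theorem exists_measurable_tp2_version_of_ae_zeros (f : (Fin 2 → ℝ) → ℝ≥0∞) (hf : Measurable f)
    (hfin : ∀ᵐ x ∂(volume : Measure (Fin 2 → ℝ)), f x ≠ ∞)
    (hMTP : ∀ᵐ q ∂(volume : Measure (Fin 2 → ℝ)).prod volume, f q.1 * f q.2 ≤ f (q.1 ⊓ q.2) * f (q.1 ⊔ q.2)) :
    ∃ F : (Fin 2 → ℝ) → ℝ≥0∞, Measurable F ∧ (∀ x, F x ≠ ∞) ∧ F =ᵐ[(volume : Measure (Fin 2 → ℝ))] f ∧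
      ∀ x y, F x * F y ≤ F (x ⊓ y) * F (x ⊔ y) := by
  classical
  -- the support and its non-null sections
  set S : Set (Fin 2 → ℝ) := {x | f x ≠ 0} with hS
  have mS : MeasurableSet S := (hf (measurableSet_singleton 0)).compl
  set X₀ : Set ℝ := {s : ℝ | volume {t : ℝ | (![s, t] : Fin 2 → ℝ) ∈ S} ≠ 0} with hX₀
  set X₁ : Set ℝ := {t : ℝ | volume {s : ℝ | (![s, t] : Fin 2 → ℝ) ∈ S} ≠ 0} with hX₁
  have mX₀ : MeasurableSet X₀ := (measurable_volume_section mS (measurableSet_singleton 0)).compl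
  have mX₁ : MeasurableSet X₁ := (measurable_volume_section' mS (measurableSet_singleton 0)).compl
  have hSP : ∀ᵐ x ∂(volume : Measure (Fin 2 → ℝ)), x ∈ S → x 0 ∈ X₀ ∧ x 1 ∈ X₁ := by
    filter_upwards [ae_apply_zero_mem mS, ae_apply_one_mem mS] with x h0 h1 hx using ⟨h0 hx, h1 hx⟩
  -- trivial case: the support is null
  by_cases htriv : volume X₀ = 0 ∨ volume X₁ = 0
  · have hf0 : f =ᵐ[(volume : Measure (Fin 2 → ℝ))] 0 := by
      have hP : ∀ᵐ x ∂(volume : Measure (Fin 2 → ℝ)), ¬(x 0 ∈ X₀ ∧ x 1 ∈ X₁) := by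
        rcases htriv with h | h
        · filter_upwards [ae_coord_of_ae 0 (measure_eq_zero_iff_ae_notMem.1 h)] with x hx h' using hx h'.1
        · filter_upwards [ae_coord_of_ae 1 (measure_eq_zero_iff_ae_notMem.1 h)] with x hx h' using hx h'.2
      filter_upwards [hSP, hP] with x hx hx'
      by_contra hne
      exact hx' (hx hne)
    refine ⟨fun _ => 0, measurable_const, fun _ => ENNReal.zero_ne_top, hf0.symm, fun _ _ => by simp⟩
  push Not at htriv
  -- the reference measures
  set X : Fin 2 → Set ℝ := ![X₀, X₁] with hXdef
  have hX0 : X 0 = X₀ := rfl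
  have hX1 : X 1 = X₁ := rfl
  set ρ : Fin 2 → Measure ℝ := fun i => (volume : Measure ℝ).restrict (X i) with hρ
  haveI : ∀ i, NeZero (ρ i) := fun i => ⟨fun h => by
    have h' : (ρ i) univ = 0 := by rw [h]; rfl
    rw [hρ, Measure.restrict_apply_univ] at h'
    fin_cases i
    · exact htriv.1 h'
    · exact htriv.2 h'⟩
  set ν : Fin 2 → Measure ℝ := fun i => (ρ i).toFinite with hν
  haveI : ∀ i, IsProbabilityMeasure (ν i) := fun i => by rw [hν]; infer_instance
  haveI : ∀ i, NullSingletonClass (ν i) := fun i =>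
    ⟨fun x => toFinite_absolutelyContinuous (ρ i) (measure_singleton x)⟩
  set P : Set (Fin 2 → ℝ) := Set.pi univ X with hP
  have mP : MeasurableSet P := MeasurableSet.univ_pi fun i => by
    fin_cases i
    · exact mX₀
    · exact mX₁
  have hmemP : ∀ {x : Fin 2 → ℝ}, x ∈ P ↔ x 0 ∈ X₀ ∧ x 1 ∈ X₁ := fun {x} => by
    simp only [hP, Set.mem_univ_pi]
    constructor
    · intro h; exact ⟨h 0, h 1⟩
    · rintro ⟨h0, h1⟩ i; fin_cases i; exacts [h0, h1]
  have hpiρ : Measure.pi ρ = (volume : Measure (Fin 2 → ℝ)).restrict P := by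
    rw [hP, volume_pi, Measure.restrict_pi_pi]
  have hρν : Measure.pi ρ ≪ Measure.pi ν := pi_absolutelyContinuous_pi_toFinite ρ
  have hνρ : Measure.pi ν ≪ Measure.pi ρ := pi_toFinite_absolutelyContinuous_pi ρ
  have hνvol : Measure.pi ν ≪ (volume : Measure (Fin 2 → ℝ)) :=
    hνρ.trans (by rw [hpiρ]; exact Measure.restrict_le_self.absolutelyContinuous)
  -- the open unit square and the transport maps
  set U : Set (Fin 2 → ℝ) := Set.pi univ fun _ => Ioo (0 : ℝ) 1 with hU
  have mU : MeasurableSet U := MeasurableSet.univ_pi fun _ => measurableSet_Ioo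
  set μ₁ : Measure (Fin 2 → ℝ) := (volume : Measure (Fin 2 → ℝ)).restrict U with hμ₁
  have hμ₁pi : μ₁ = Measure.pi fun _ : Fin 2 => (volume : Measure ℝ).restrict (Ioo (0 : ℝ) 1) := by
    rw [hμ₁, hU, volume_pi, Measure.restrict_pi_pi]
  set T : (Fin 2 → ℝ) → (Fin 2 → ℝ) := fun u i => rqe (ν i) (u i) with hT
  set R : (Fin 2 → ℝ) → (Fin 2 → ℝ) := fun x i => cdf (ν i) (x i) with hR
  have hTmp : MeasurePreserving T μ₁ (Measure.pi ν) := by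
    rw [hμ₁pi]
    exact measurePreserving_pi _ _ fun i => measurePreserving_rqe (ν i)
  have hT_meas : Measurable T := hTmp.measurable
  have hR_meas : Measurable R :=
    measurable_pi_iff.2 fun i => (monotone_cdf (ν i)).measurable.comp (measurable_pi_apply i)
  have haeU : ∀ᵐ u ∂μ₁, u ∈ U := ae_restrict_mem mU
  have hRT : ∀ᵐ u ∂μ₁, R (T u) = u := by
    filter_upwards [haeU] with u hu
    funext i
    have hui := Set.mem_univ_pi.1 hu i
    show cdf (ν i) (rqe (ν i) (u i)) = u i
    rw [rqe_of_mem _ hui, cdf_rq_eq _ hui]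
  have hRlat : ∀ x y, R (x ⊓ y) = R x ⊓ R y ∧ R (x ⊔ y) = R x ⊔ R y := fun x y =>
    ⟨funext fun i => (monotone_cdf (ν i)).map_inf (x i) (y i),
      funext fun i => (monotone_cdf (ν i)).map_sup (x i) (y i)⟩
  have hTlat : ∀ x ∈ U, ∀ y ∈ U, T (x ⊓ y) = T x ⊓ T y ∧ T (x ⊔ y) = T x ⊔ T y := fun x hx y hy =>
    ⟨funext fun i => (monotoneOn_rqe (ν i)).map_inf (Set.mem_univ_pi.1 hx i) (Set.mem_univ_pi.1 hy i),
      funext fun i => (monotoneOn_rqe (ν i)).map_sup (Set.mem_univ_pi.1 hx i) (Set.mem_univ_pi.1 hy i)⟩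
  have hUinf : ∀ x ∈ U, ∀ y ∈ U, x ⊓ y ∈ U := fun x hx y hy => Set.mem_univ_pi.2 fun i =>
    ⟨lt_min (Set.mem_univ_pi.1 hx i).1 (Set.mem_univ_pi.1 hy i).1, (min_le_left _ _).trans_lt (Set.mem_univ_pi.1 hx i).2⟩
  have hUsup : ∀ x ∈ U, ∀ y ∈ U, x ⊔ y ∈ U := fun x hx y hy => Set.mem_univ_pi.2 fun i =>
    ⟨(Set.mem_univ_pi.1 hx i).1.trans_le (le_max_left _ _), max_lt (Set.mem_univ_pi.1 hx i).2 (Set.mem_univ_pi.1 hy i).2⟩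
  -- the transported density
  set g : (Fin 2 → ℝ) → ℝ≥0∞ := f ∘ T with hg
  have hgm : Measurable g := hf.comp hT_meas
  have hqmp : Measure.QuasiMeasurePreserving T μ₁ (volume : Measure (Fin 2 → ℝ)) :=
    ⟨hT_meas, by rw [hTmp.map_eq]; exact hνvol⟩
  have hqmp2 := MeasureTheory.QuasiMeasurePreserving.prodMap hqmp hqmp
  have haeU2 : ∀ᵐ p ∂μ₁.prod μ₁, p.1 ∈ U ∧ p.2 ∈ U := by
    filter_upwards [(Measure.quasiMeasurePreserving_fst (μ := μ₁) (ν := μ₁)).ae haeU,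
      (Measure.quasiMeasurePreserving_snd (μ := μ₁) (ν := μ₁)).ae haeU] with p h1 h2 using ⟨h1, h2⟩
  have hgMTP : ∀ᵐ q ∂μ₁.prod μ₁, g q.1 * g q.2 ≤ g (q.1 ⊓ q.2) * g (q.1 ⊔ q.2) := by
    filter_upwards [hqmp2.ae hMTP, haeU2] with q hq hqU
    simp only [hg, Function.comp_apply, (hTlat q.1 hqU.1 q.2 hqU.2).1, (hTlat q.1 hqU.1 q.2 hqU.2).2]
    exact hq
  have hgfin : ∀ᵐ u ∂μ₁, g u ≠ ∞ := hqmp.ae hfin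
  -- its support is an almost sublattice, a.e. equal to an honest one inside the square
  set S' : Set (Fin 2 → ℝ) := {u | g u ≠ 0} with hS'
  have mS' : MeasurableSet S' := (hgm (measurableSet_singleton 0)).compl
  have hS'T : ∀ u, u ∈ S' ↔ T u ∈ S := fun u => Iff.rfl
  have hae : ∀ᵐ p ∂(Measure.pi fun _ : Fin 2 => (volume : Measure ℝ).restrict (Ioo (0 : ℝ) 1)).prod
      (Measure.pi fun _ : Fin 2 => (volume : Measure ℝ).restrict (Ioo (0 : ℝ) 1)),
      p.1 ∈ S' → p.2 ∈ S' → p.1 ⊓ p.2 ∈ S' ∧ p.1 ⊔ p.2 ∈ S' := by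
    rw [← hμ₁pi]
    filter_upwards [hgMTP] with p hp h1 h2
    have hL : g p.1 * g p.2 ≠ 0 := mul_ne_zero h1 h2
    have hR : g (p.1 ⊓ p.2) * g (p.1 ⊔ p.2) ≠ 0 := fun h => hL (le_zero_iff.1 (h ▸ hp))
    exact ⟨(mul_ne_zero_iff.1 hR).1, (mul_ne_zero_iff.1 hR).2⟩
  obtain ⟨L₀, mL₀, -, hL₀ae, hL₀inf, hL₀sup⟩ :=
    exists_measurable_sublattice_version_of_ae (fun _ : Fin 2 => (volume : Measure ℝ).restrict (Ioo (0 : ℝ) 1)) mS' hae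
  rw [← hμ₁pi] at hL₀ae
  set L : Set (Fin 2 → ℝ) := L₀ ∩ U with hL
  have mL : MeasurableSet L := mL₀.inter mU
  have hLU : L ⊆ U := Set.inter_subset_right
  have hLinf : ∀ x ∈ L, ∀ y ∈ L, x ⊓ y ∈ L := fun x hx y hy => ⟨hL₀inf hx.1 hy.1, hUinf x hx.2 y hy.2⟩
  have hLsup : ∀ x ∈ L, ∀ y ∈ L, x ⊔ y ∈ L := fun x hx y hy => ⟨hL₀sup hx.1 hy.1, hUsup x hx.2 y hy.2⟩
  -- `L = S'` almost everywhere on the square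
  have hLS' : ∀ᵐ u ∂(volume : Measure (Fin 2 → ℝ)), u ∈ U → (u ∈ L ↔ u ∈ S') := by
    have h1 : ∀ᵐ u ∂μ₁, (u ∈ L₀ ↔ u ∈ S') := by
      filter_upwards [hL₀ae] with u hu
      exact ⟨fun h => by rwa [← show (u ∈ L₀) = (u ∈ S') from hu], fun h => by rwa [show (u ∈ L₀) = (u ∈ S') from hu]⟩
    have h2 := (ae_restrict_iff' mU).1 h1
    filter_upwards [h2] with u hu huU
    rw [← hu huU]
    exact ⟨fun h => h.1, fun h => ⟨h, huU⟩⟩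
  -- FULLNESS: almost every line of the square meets `L`
  have hνX : ∀ i, ν i ≪ (volume : Measure ℝ).restrict (X i) := fun i => by
    rw [hν]; exact toFinite_absolutelyContinuous (ρ i)
  have hXν : ∀ i, (volume : Measure ℝ).restrict (X i) ≪ ν i := fun i => by
    rw [hν]; exact absolutelyContinuous_toFinite (ρ i)
  have mXi : ∀ i, MeasurableSet (X i) := fun i => by
    fin_cases i
    · exact mX₀
    · exact mX₁
  have hLS : ∀ᵐ u ∂(volume : Measure (Fin 2 → ℝ)), u ∈ U → (u ∈ L ↔ (fun i => rqe (ν i) (u i)) ∈ S) := hLS'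
  have hX1d : ∀ᵐ a ∂(volume : Measure ℝ), volume ({r : ℝ | (![a, r] : Fin 2 → ℝ) ∈ S} \ X 1) = 0 := by
    have h0 : volume (S \ {x : Fin 2 → ℝ | x 1 ∈ X₁}) = 0 :=
      measure_eq_zero_iff_ae_notMem.2 (by
        filter_upwards [ae_apply_one_mem mS] with x hx h using h.2 (hx h.1))
    have mD : MeasurableSet (S \ {x : Fin 2 → ℝ | x 1 ∈ X₁}) := mS.diff (measurable_pi_apply 1 mX₁)
    rw [volume_eq_lintegral_sections mD, lintegral_eq_zero_iff (measurable_volume_section mD)] at h0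
    filter_upwards [h0] with a ha
    have e : {r : ℝ | (![a, r] : Fin 2 → ℝ) ∈ S} \ X 1 = {t : ℝ | (![a, t] : Fin 2 → ℝ) ∈ S \ {x | x 1 ∈ X₁}} := by
      ext r; simp [hX1]
    rw [e]; exact ha
  have hX0d : ∀ᵐ b ∂(volume : Measure ℝ), volume ({r : ℝ | (![r, b] : Fin 2 → ℝ) ∈ S} \ X 0) = 0 := by
    have h0 : volume (S \ {x : Fin 2 → ℝ | x 0 ∈ X₀}) = 0 :=
      measure_eq_zero_iff_ae_notMem.2 (by
        filter_upwards [ae_apply_zero_mem mS] with x hx h using h.2 (hx h.1))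
    have mD : MeasurableSet (S \ {x : Fin 2 → ℝ | x 0 ∈ X₀}) := mS.diff (measurable_pi_apply 0 mX₀)
    rw [volume_eq_lintegral_sections' mD, lintegral_eq_zero_iff (measurable_volume_section' mD)] at h0
    filter_upwards [h0] with b hb
    have e : {r : ℝ | (![r, b] : Fin 2 → ℝ) ∈ S} \ X 0 = {s : ℝ | (![s, b] : Fin 2 → ℝ) ∈ S \ {x | x 0 ∈ X₀}} := by
      ext r; simp [hX0]
    rw [e]; exact hb
  have hfull0 : ∀ᵐ s ∂(volume : Measure ℝ), s ∈ Ioo (0 : ℝ) 1 → ∃ z ∈ L, z 0 = s :=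
    ae_vertical_line_meets mS mXi (fun a ha => by rw [hX0] at ha; exact ha) hX1d ν hνX hXν mL hLS
  have hfull1 : ∀ᵐ t ∂(volume : Measure ℝ), t ∈ Ioo (0 : ℝ) 1 → ∃ z ∈ L, z 1 = t :=
    ae_horizontal_line_meets mS mXi (fun b hb => by rw [hX1] at hb; exact hb) hX0d ν hνX hXν mL hLS
  -- the band
  obtain ⟨B, hB, hBU, hBL⟩ := exists_isBand_ae_eq mL hLU hLinf hLsup hfull0 hfull1
  have hBS' : ∀ᵐ u ∂(volume : Measure (Fin 2 → ℝ)), u ∈ U → (u ∈ B ↔ g u ≠ 0) := by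
    filter_upwards [hBL, hLS'] with u hu hu' huU
    rw [show (u ∈ B) = (u ∈ L) from hu]
    exact (hu' huU).trans Iff.rfl
  -- the band theorem for `𝟙_B g`
  set g' : (Fin 2 → ℝ) → ℝ≥0∞ := B.indicator g with hg'
  have hg'm : Measurable g' := hgm.indicator hB.isOpen.measurableSet
  have hgfin' : ∀ᵐ u ∂(volume : Measure (Fin 2 → ℝ)), u ∈ U → g u ≠ ∞ := (ae_restrict_iff' mU).1 hgfin
  have hpos' : ∀ᵐ x ∂(volume : Measure (Fin 2 → ℝ)), x ∈ B → g' x ≠ 0 ∧ g' x ≠ ∞ := by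
    filter_upwards [hBS', hgfin'] with x hx hx' hxB
    rw [hg', Set.indicator_of_mem hxB]
    exact ⟨(hx (hBU hxB)).1 hxB, hx' (hBU hxB)⟩
  have hzero' : ∀ᵐ x ∂(volume : Measure (Fin 2 → ℝ)), x ∉ B → g' x = 0 :=
    Eventually.of_forall fun x hx => Set.indicator_of_notMem hx _
  have hgMTP' : ∀ᵐ q ∂(volume : Measure (Fin 2 → ℝ)).prod volume,
      q.1 ∈ U → q.2 ∈ U → g q.1 * g q.2 ≤ g (q.1 ⊓ q.2) * g (q.1 ⊔ q.2) := by
    have h := hgMTP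
    rw [hμ₁, Measure.prod_restrict, ae_restrict_iff' (mU.prod mU)] at h
    filter_upwards [h] with q hq h1 h2 using hq ⟨h1, h2⟩
  have hMTP' : ∀ᵐ q ∂(volume : Measure (Fin 2 → ℝ)).prod volume,
      g' q.1 * g' q.2 ≤ g' (q.1 ⊓ q.2) * g' (q.1 ⊔ q.2) := by
    filter_upwards [hgMTP'] with q hq
    by_cases h1 : q.1 ∈ B
    · by_cases h2 : q.2 ∈ B
      · simp only [hg', Set.indicator_of_mem h1, Set.indicator_of_mem h2, Set.indicator_of_mem (hB.inf_mem _ h1 _ h2),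
          Set.indicator_of_mem (hB.sup_mem _ h1 _ h2)]
        exact hq (hBU h1) (hBU h2)
      · rw [hg', Set.indicator_of_notMem h2, mul_zero]; exact zero_le
    · rw [hg', Set.indicator_of_notMem h1, zero_mul]; exact zero_le
  obtain ⟨G, hGm, hGB, hGB', hGae, hGtp⟩ := exists_measurable_tp2_version_of_ae_band hB g' hg'm hpos' hzero' hMTP'
  -- `G = g` almost everywhere on the square
  have hGg : ∀ᵐ u ∂μ₁, G u = g u := by
    rw [hμ₁, ae_restrict_iff' mU]
    filter_upwards [hGae, hBS'] with u hu hu' huU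
    rw [hu, hg']
    by_cases huB : u ∈ B
    · rw [Set.indicator_of_mem huB]
    · rw [Set.indicator_of_notMem huB]
      have : ¬ g u ≠ 0 := fun h => huB ((hu' huU).2 h)
      exact (not_not.1 this).symm
  -- pull back along the distribution functions
  have hPinf : ∀ x ∈ P, ∀ y ∈ P, x ⊓ y ∈ P := fun x hx y hy =>
    hmemP.2 (inf_sup_mem_prodSet (hmemP.1 hx) (hmemP.1 hy)).1
  have hPsup : ∀ x ∈ P, ∀ y ∈ P, x ⊔ y ∈ P := fun x hx y hy =>
    hmemP.2 (inf_sup_mem_prodSet (hmemP.1 hx) (hmemP.1 hy)).2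
  refine ⟨P.indicator (G ∘ R), (hGm.comp hR_meas).indicator mP, fun x => ?_, ?_, fun x y => ?_⟩
  · by_cases hx : x ∈ P
    · rw [Set.indicator_of_mem hx, Function.comp_apply]
      by_cases hRx : R x ∈ B
      · exact (hGB _ hRx).2
      · rw [hGB' _ hRx]; exact ENNReal.zero_ne_top
    · rw [Set.indicator_of_notMem hx]; exact ENNReal.zero_ne_top
  · -- the version property
    have h1 : ∀ᵐ u ∂μ₁, G (R (T u)) = f (T u) := by
      filter_upwards [hGg, hRT] with u hu huR
      rw [huR, hu]; rfl
    have h2 : ∀ᵐ y ∂μ₁.map T, G (R y) = f y :=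
      (ae_map_iff hT_meas.aemeasurable (measurableSet_eq_fun (hGm.comp hR_meas) hf)).2 h1
    rw [hTmp.map_eq] at h2
    have h3 : ∀ᵐ y ∂(volume : Measure (Fin 2 → ℝ)).restrict P, G (R y) = f y := by
      rw [← hpiρ]; exact hρν.ae_le h2
    have h4 := (ae_restrict_iff' mP).1 h3
    filter_upwards [h4, hSP] with y hy hyS
    by_cases hyP : y ∈ P
    · rw [Set.indicator_of_mem hyP, Function.comp_apply, hy hyP]
    · rw [Set.indicator_of_notMem hyP]
      by_contra hne
      exact hyP (hmemP.2 (hyS (Ne.symm hne)))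
  · by_cases hx : x ∈ P
    · by_cases hy : y ∈ P
      · rw [Set.indicator_of_mem hx, Set.indicator_of_mem hy, Set.indicator_of_mem (hPinf x hx y hy),
          Set.indicator_of_mem (hPsup x hx y hy)]
        simp only [Function.comp_apply]
        rw [(hRlat x y).1, (hRlat x y).2]
        exact hGtp (R x) (R y)
      · rw [Set.indicator_of_notMem hy, mul_zero]; exact zero_le
    · rw [Set.indicator_of_notMem hx, zero_mul]; exact zero_le

/-! ### Corollaries: TP₂ laws in the plane, and `ℝ × ℝ` -/

/-- **TP₂ laws in the plane have everywhere-TP₂ Borel densities (zeros allowed).**  If `f : ℝ² → [0,∞]` is measurable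
and integrable and the law `λ² · f` is TP₂ on closed boxes, then `λ² · f = λ² · F` for a Borel, everywhere-finite `F`
with `F(x) F(y) ≤ F(x ∧ y) F(x ∨ y)` at EVERY pair. [this work] -/
theorem exists_tp2_density_of_isBoxTP2_plane_zeros (f : (Fin 2 → ℝ) → ℝ≥0∞) (hf : Measurable f)
    (hint : ∫⁻ z, f z ∂(volume : Measure (Fin 2 → ℝ)) ≠ ∞)
    (h : IsBoxTP2 ((volume : Measure (Fin 2 → ℝ)).withDensity f)) :
    ∃ F : (Fin 2 → ℝ) → ℝ≥0∞, Measurable F ∧ (∀ x, F x ≠ ∞) ∧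
      (volume : Measure (Fin 2 → ℝ)).withDensity F = (volume : Measure (Fin 2 → ℝ)).withDensity f ∧
      ∀ x y, F x * F y ≤ F (x ⊓ y) * F (x ⊔ y) := by
  have hae : ∀ᵐ p : (Fin 2 → ℝ) × (Fin 2 → ℝ) ∂((volume : Measure (Fin 2 → ℝ)).prod volume),
      f p.1 * f p.2 ≤ f (p.1 ⊓ p.2) * f (p.1 ⊔ p.2) := by
    have h' := (isBoxTP2_withDensity_pi_iff_ae (fun _ : Fin 2 => (volume : Measure ℝ)) f hf
      (by rw [← volume_pi]; exact hint)).1 (by rw [← volume_pi]; exact h)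
    rwa [← volume_pi] at h'
  have hfin : ∀ᵐ x ∂(volume : Measure (Fin 2 → ℝ)), f x ≠ ∞ := by
    filter_upwards [ae_lt_top hf hint] with x hx using hx.ne
  obtain ⟨F, hFm, hFb, hFf, hFmtp⟩ := exists_measurable_tp2_version_of_ae_zeros f hf hfin hae
  exact ⟨F, hFm, hFb, withDensity_congr_ae hFf, hFmtp⟩

/-- **Box-TP₂ ⟺ an everywhere-TP₂ Borel density, for EVERY law on the plane with an integrable density** (no
positivity). [this work] -/
theorem isBoxTP2_iff_exists_tp2_density_plane_zeros (f : (Fin 2 → ℝ) → ℝ≥0∞) (hf : Measurable f)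
    (hint : ∫⁻ z, f z ∂(volume : Measure (Fin 2 → ℝ)) ≠ ∞) :
    IsBoxTP2 ((volume : Measure (Fin 2 → ℝ)).withDensity f) ↔
      ∃ F : (Fin 2 → ℝ) → ℝ≥0∞, Measurable F ∧
        (volume : Measure (Fin 2 → ℝ)).withDensity F = (volume : Measure (Fin 2 → ℝ)).withDensity f ∧
        ∀ x y, F x * F y ≤ F (x ⊓ y) * F (x ⊔ y) := by
  refine ⟨fun h => ?_, fun ⟨F, hFm, hFeq, hFmtp⟩ => ?_⟩
  · obtain ⟨F, hFm, -, hFeq, hFmtp⟩ := exists_tp2_density_of_isBoxTP2_plane_zeros f hf hint h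
    exact ⟨F, hFm, hFeq, hFmtp⟩
  · rw [← hFeq, volume_pi]
    exact isBoxTP2_withDensity_pi_of_ae (fun _ : Fin 2 => (volume : Measure ℝ)) F hFm
      (Eventually.of_forall fun p => hFmtp p.1 p.2)

/-- **The planar structure theorem for densities with zeros on `ℝ × ℝ`.** [this work] -/
theorem exists_measurable_tp2_version_of_ae_zeros_prod (f : ℝ × ℝ → ℝ≥0∞) (hf : Measurable f)
    (hfin : ∀ᵐ x ∂(volume : Measure (ℝ × ℝ)), f x ≠ ∞)
    (hMTP : ∀ᵐ p : (ℝ × ℝ) × (ℝ × ℝ) ∂((volume : Measure (ℝ × ℝ)).prod volume),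
      f p.1 * f p.2 ≤ f (p.1 ⊓ p.2) * f (p.1 ⊔ p.2)) :
    ∃ F : ℝ × ℝ → ℝ≥0∞, Measurable F ∧ (∀ x, F x ≠ ∞) ∧ F =ᵐ[volume] f ∧ ∀ x y, F x * F y ≤ F (x ⊓ y) * F (x ⊔ y) := by
  set e := (MeasurableEquiv.finTwoArrow (α := ℝ)) with he_def
  have he : MeasurePreserving e (volume : Measure (Fin 2 → ℝ)) (volume : Measure (ℝ × ℝ)) :=
    MeasureTheory.volume_preserving_finTwoArrow ℝ
  have he_apply : ∀ x : Fin 2 → ℝ, e x = (x 0, x 1) := fun x => by simp [he_def]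
  have helat : ∀ x y : Fin 2 → ℝ, e (x ⊓ y) = e x ⊓ e y ∧ e (x ⊔ y) = e x ⊔ e y := fun x y => by
    simp only [he_apply, Pi.inf_apply, Pi.sup_apply, Prod.mk_inf_mk, Prod.mk_sup_mk, and_self]
  have hMTP' : ∀ᵐ p : (Fin 2 → ℝ) × (Fin 2 → ℝ) ∂((volume : Measure (Fin 2 → ℝ)).prod volume),
      (f ∘ e) p.1 * (f ∘ e) p.2 ≤ (f ∘ e) (p.1 ⊓ p.2) * (f ∘ e) (p.1 ⊔ p.2) := by
    filter_upwards [(he.prod he).quasiMeasurePreserving.ae hMTP] with p hp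
    simp only [Function.comp_apply, (helat p.1 p.2).1, (helat p.1 p.2).2]
    exact hp
  have hfin' : ∀ᵐ x ∂(volume : Measure (Fin 2 → ℝ)), (f ∘ e) x ≠ ∞ := he.quasiMeasurePreserving.ae hfin
  obtain ⟨F', hF'm, hF'b, hF'f, hF'tp⟩ :=
    exists_measurable_tp2_version_of_ae_zeros (f ∘ e) (hf.comp e.measurable) hfin' hMTP'
  refine ⟨F' ∘ e.symm, hF'm.comp e.symm.measurable, fun x => hF'b _, ?_, fun x y => ?_⟩
  · have h1 : ∀ᵐ q ∂(volume : Measure (ℝ × ℝ)), F' (e.symm q) = f (e (e.symm q)) :=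
      he.symm.quasiMeasurePreserving.ae hF'f
    filter_upwards [h1] with q hq
    rw [Function.comp_apply, hq, e.apply_symm_apply]
  · have h := hF'tp (e.symm x) (e.symm y)
    have hi : e.symm x ⊓ e.symm y = e.symm (x ⊓ y) := by
      apply e.injective
      rw [(helat _ _).1, e.apply_symm_apply, e.apply_symm_apply, e.apply_symm_apply]
    have hs : e.symm x ⊔ e.symm y = e.symm (x ⊔ y) := by
      apply e.injective
      rw [(helat _ _).2, e.apply_symm_apply, e.apply_symm_apply, e.apply_symm_apply]
    simp only [Function.comp_apply]
    rwa [hi, hs] at h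

end Plane

end Summit.CriticalPhenomena.PercolationContinuityZ3.Theorems.SahiAEFourFunctions
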